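import HarnessLib
import Literature.MathematicalPhysics.QuantumFieldTheory.Balaban1983to89.Beta.LeafBlockLegs
import Literature.MathematicalPhysics.QuantumFieldTheory.Balaban1983to89.B4Ineq116Torus

/-!
# Beta / LeafBlockLegsMassless — the block-leg supplier package `BlockLegDecay` of `Beta/LeafK123Clauses`,
# HYPOTHESIS-FREE for Bałaban's massless scalar torus tower in `d ≥ 3` (value + gradient legs:
# `Beta/LeafBlockLegs`; covariance: pv07's `B4Ineq116Torus.cov116_torus` at `m² = 0`)

HONEST FRAMING (verbatim, page 1 of everything this cell writes): discharging `BetaPertH` makes Bałaban's UV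
stability UNCONDITIONAL — a real constructive-QFT result; it is NOT the continuum limit and NOT the Clay problem.
ABSOLUTE RULE: no internally-minted statement enters as a cited fact; every hypothesis below is either kernel-proved in
the tree or an explicit hypothesis of the theorem that uses it.  THIS MODULE asserts nothing printed: it is a one-screen
COMBINATION of two tree certificates about the concrete SCALAR (`U = 1`), MASSLESS (`m² = 0`) torus tower
`B1RG242Torus.tower P a 0`.  Zero cited facts, zero `sorry`.

WHAT IS PROVED.
* `covDecay_of_levelUnits`: covariance decay in level-`j` units (`|C_j^{resc}(y,y′)| ≤ c e^{−δ T^{(j)}(y,y′)}`, the form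
  of `B4Ineq116Torus.cov116_torus`) IS an1's `LeafK123Clauses.CovDecay` (fine units `L^{−j}T^{(0)}(fine y, fine y′)`;
  `B5Ineq137Torus.T_fine_fine`).
* `blockLegDecay_massless (d L) (hd : 3 ≤ d) (hL : Odd L ∧ 1 < L) (ha : 0 < a) :
    ∃ c δ, 0 ≤ c ∧ 0 < δ ∧ ∀ P : Params, P.d = d → P.L = L → BlockLegDecay P a 0 c δ` —
  the constants are chosen from `(d, L, a)` BEFORE the volume/cutoff data `P` (`m`, `K`): value and gradient legs
  `LeafBlockLegs.valDecay/gradDecay` (constants `cLeg d a`, `dLeg d a`), covariance `B4Ineq116Torus.cov116_torus d L … 0`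
  (pv07-g7; cap `m²₊ = 0`, mass `0`), glued by `LeafBlockLegs.blockLegDecay_of_covDecay`.
CONSEQUENCE (by name, not restated): `LeafK123Clauses.leafK123_data{M,V,G}` and the three `(W3a)₀` tails
`{mixed,value,grad}Leg_tail_of_blockLegDecay` hold for the massless scalar torus tower in `d ≥ 3` with the package
supplied here (their remaining binders `cK0 ≤ c₀`, `δ₀′ ≤ dK0`, `|a_j| ≤ ā` are the consumer's bookkeeping via
`BlockLegDecay.mono`).

HONEST SCOPE: `m² = 0`, `d ≥ 3`, scalar `U = 1`; nothing about `U ≠ 1`, the vector propagator, or positive mass.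
Context (located, not used in proofs, not cited as facts): [B4] p. 582 Lemma 2.4 (2.35)–(2.37); [B5] p. 40
(1.136)–(1.137).  B4 = [cite: Balaban1983RegularityDecay]; B5 = [cite: Balaban1984PropagatorsI].
-/

namespace Literature.MathematicalPhysics.QuantumFieldTheory.Balaban1983to89

noncomputable section

namespace Beta.LeafBlockLegsMassless

open B5Display136Torus (Crs)
open B5Ineq137Torus (T)
open Beta.LeafK123Clauses (CovDecay BlockLegDecay)
open Beta.LeafBlockLegs (cLeg dLeg cLeg_nonneg dLeg_pos blockLegDecay_of_covDecay)

variable {P : Params}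

/-- Covariance decay stated in level-`j` units (`T P j y y′`, the form of pv07's `B4Ineq116Torus.cov116_torus`) is
an1's `CovDecay` (fine units `L^{−j}T(fine y, fine y′)`, `B5Ineq137Torus.T_fine_fine`). [folklore] -/
theorem covDecay_of_levelUnits {a msq c δ : ℝ}
    (h : ∀ j : ℕ, 1 ≤ j → j ≤ P.m + P.K → ∀ y y' : Site P j,
      |Crs P a msq j y y'| ≤ c * Real.exp (-(δ * T P j y y'))) :
    CovDecay P a msq c δ := by
  intro j hj1 hj y y'
  rw [B5Ineq137Torus.T_fine_fine P hj, inv_mul_cancel_left₀ (pow_pos P.cast_L_pos j).ne']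
  exact h j hj1 hj y y'

/-- **THE SUPPLIER PACKAGE, HYPOTHESIS-FREE, for the massless scalar torus tower in `d ≥ 3`**: constants `(c, δ)`
chosen from `(d, L, a)` BEFORE the volume/cutoff data `P` such that `BlockLegDecay P a 0 c δ` for every `P` with
`P.d = d`, `P.L = L` — value/gradient legs from `Beta/LeafBlockLegs`, covariance from pv07's
`B4Ineq116Torus.cov116_torus` at `m² = 0` (cap `m²₊ = 0`). [folklore] -/
theorem blockLegDecay_massless (d L : ℕ) (hd : 3 ≤ d) (hL : Odd L ∧ 1 < L) {a : ℝ} (ha : 0 < a) :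
    ∃ c δ : ℝ, 0 ≤ c ∧ 0 < δ ∧ ∀ P : Params, P.d = d → P.L = L → BlockLegDecay P a 0 c δ := by
  obtain ⟨δ₀, c₀, hδ₀, hc₀, hcov⟩ := B4Ineq116Torus.cov116_torus d L (by omega) hL ha 0
  refine ⟨max (cLeg d a) c₀, min (dLeg d a) δ₀, (cLeg_nonneg ha).trans (le_max_left _ _),
    lt_min (dLeg_pos ha) hδ₀, fun P hPd hPL => ?_⟩
  subst hPd
  subst hPL
  have hcovP : CovDecay P a 0 c₀ δ₀ :=
    covDecay_of_levelUnits fun j hj1 hj y y' => hcov P rfl rfl 0 le_rfl j hj1 hj (mul_zero _).le y y'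
  exact blockLegDecay_of_covDecay hd ha hc₀ hcovP

/-- The package at `d = 4` (the case of interest), any odd `L > 1`, any `a > 0`. [folklore] -/
example (L : ℕ) (hL : Odd L ∧ 1 < L) {a : ℝ} (ha : 0 < a) :
    ∃ c δ : ℝ, 0 ≤ c ∧ 0 < δ ∧ ∀ P : Params, P.d = 4 → P.L = L → BlockLegDecay P a 0 c δ :=
  blockLegDecay_massless 4 L (by norm_num) hL ha

end Beta.LeafBlockLegsMassless

end

end Literature.MathematicalPhysics.QuantumFieldTheory.Balaban1983to89
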